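import Summits.QuantumFields.BalabanUV.Beta.D1BFx.LandauDictionaryHOps
import Summits.QuantumFields.BalabanUV.Beta.D1BFx.ProjectorGaugeBlockConst
import Literature.MathematicalPhysics.QuantumFieldTheory.Balaban1983to89.Beta.KKTFluctuationUnique
import Literature.MathematicalPhysics.QuantumFieldTheory.Balaban1983to89.Beta.ResolventComposition

/-!
# Road BF-x, slot (K) dictionary brick B6 (DICT-H): THE TYPED MINIMISER KERNEL `wH` IS THE R-WEIGHTED REDUCED COLUMN `ℋ_R = Ga𝒬ᵀCun`
# (`wΦ`, `wM` alongside) — CONDITIONAL on the DISPLAYED vector-leg equations X₁a∕X₁b of `Ga`∕`Cun` (an5's debt; NOT asserted here)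

HONEST DEPENDENCY (page 1, mandatory): continuum YM on T⁴ ⇐ BetaPertH ∧ nine spine estimates (0/9 proved); BetaPertH ⇐ (D1) ∧ (D4) ∧
CAP+tail; G-an2-4 gates asym, D1 and NE2/3/4.  HONEST FRAMING (cell contract, verbatim): «discharging `BetaPertH` makes Bałaban's UV
stability UNCONDITIONAL — a real constructive-QFT result; it is NOT the continuum limit and NOT the Clay problem.»  THIS MODULE is brick B6 of
the road owner's claim table `HOME/b2b-balaban-beta-d1-p2/DICT-BRICKS.md` v1.1 («intended Lean signature» `wH_eq_HRcol`): two [our object] data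
definitions (`HRcol`, `muCol` — bodies, not Props) and the verification of `KKTFluctuationUnique.SolvesKKT` for the candidate (`HRcol`, `c•Cun − a′•δ`,
`muCol`) from bricks B1 (`LandauMultiplierMean`), B3 (`ProjectorGaugeBlockConst`), B4 (`KernelFormOperators`), B5 (`TowerEquationForms`) and part 1
(`LandauDictionaryHOps`) BY NAME, closed by the tree's UNIQUENESS `KKTFluctuationUnique.eq_wH_of_solvesKKT`.  The two vector-leg equations
(X₁a) «`S(Ga e) + d R δ(Ga e) + a′𝒬ᵀ𝒬(Ga e) = c·e` for every unit bond source `e`» and (X₁b) «`𝒬(Ga𝒬ᵀCun) = 1`» are DISPLAYED HYPOTHESES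
about ABSTRACT kernels `Ga`, `Cun` (an5's X₁ for `GluonLeg.Ga`, `CoarseLeg.Cun`; REQUEST journal 17:38Z) — NOTHING says they hold; the theorem
is the honest conditional «dictionary line (D-H) ⟸ X₁».  No `def … : Prop`, nothing cited, 0 sorry.  0∕4 binders of row D1 (hW, hR, D1Tel, D1Rep)
discharged; NOT D1, NOT BetaPertH, NOT continuum, NOT Clay.

ABSOLUTE RULE (cell charter, verbatim): «No internally-minted statement may enter as a cited fact. Every hypothesis is either kernel-proved
in this package or a verbatim quotation of a PUBLISHED theorem with page reference. The manuscript(s) under audit are NOT citable for their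
own disputed steps — they are the thing under adjudication; programme-internal (2001/route/tribunal) claims are never citable.»

PROOF ROUTE (K-R1-SPEC v2 §2 (D-H); owner memo g4 §3 (1)).  `A := HRcol = kerOp₁ Ga (𝒬ᵀ Cun-col)`; superpose X₁a over the source bonds with the
bounded weight `𝒬ᵀ Cun-col` (`el_superposed`: B4's stencils-through-`Σ'` + part 1's `R`-term exchange) ⟹ `S A + d(RδA) + a′𝒬ᵀ𝒬A = c·𝒬ᵀCun-col`;
X₁b ⟹ `𝒬A = δ`; `μ := −n²·G′R(δA)` (B1's `RG` shape = `Gf (Rf ·)` by part 1) has `Δ₀μ = −RδA` (B5 + B4) and zero block sums (B1): (el) with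
`φ := c•Cun-col − a′•δ`; (gauge) `δ∘S = 0` (`ResolventComposition.codiff₁_curvAdj`), `δ𝒬ᵀ(·)` block-constant (`isBlockConst_codiff₁_contourSumAdj`)
and `Δ₀PδA` block-constant (B3 `isBlockConst_codiff₁_dz_Pf`); (mean) B1; (avg) X₁b; tempered ⟸ bounded.
CONTENT. §1 `HRcol`, `muCol` + bounds; §2 **`el_superposed`**; §3 `solvesKKT_HRcol`; §4 **`wH_eq_HRcol`** (the tabled signature, `Pf` of B4 inside X₁a
as `Rf n a (codiff₁ ·) = codiff₁ · − Pf n a (codiff₁ ·)`).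
Unit `b2b-balaban-beta-d1-formalise-leaf-06` (gen 6), 2026-08-20; `DICT-BRICKS.md` row B6; INTENT «DICT-B6» (journal l.19053).
-/

namespace Summit.QuantumFields.BalabanUV.Beta.D1BFx.LandauDictionaryH

open Finset
open scoped BigOperators
open Literature.MathematicalPhysics.QuantumFieldTheory.Balaban1983to89
open Literature.MathematicalPhysics.QuantumFieldTheory.Balaban1983to89.Beta
open ExpKernelCalculus (Site MKer Decays Zl Zl_nonneg)
open B12Sec2to5 (l1 l1_nonneg)
open AffineAveraging (Form0 Form1 box toSite unitVec dz curv curvAdj codiff₁ blockSum contourSum)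
open AffineReproduction (contourSumAdj IsBlockConst codiff₁_sub dz_sub)
open KKTFluctuationKernel (delta1 delta1_apply)
open KKTFluctuationUnique (SolvesKKT Tempered0 Tempered1 eq_wH_of_solvesKKT)
open KernelSpecInstance (wH wΦ wM hasSum_contourSumAdj codiff₁_smul dz_smul)
open ResolventComposition (codiff₁_curvAdj isBlockConst_codiff₁_contourSumAdj)
open Summit.QuantumFields.BalabanUV.Beta.TameKernelCalculus (Spr)
open GhostLeg (Ggh)
open RProjector (Pgt)
open RProjectorJet (RG)
open KernelFormOperators (kerOp kerOp₁ Pf Rf Rf_eq abs_kerOp₁_le hasSum_curvAdj_curv_kerOp₁ hasSum_contourSum_kerOp₁ bound_nonneg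
  exists_bound_Rf abs_kerOp_le)
open LandauMultiplierMean (spr_Pgt)
open TowerEquationForms (Gf)
open ProjectorGaugeBlockConst (isBlockConst_codiff₁_dz_Pf)
open LandauDictionaryHOps (codiff₁_superpos dz_superpos₀ Rf_superpos opEL_superpos' QtQ_superpos delta1_superpos abs_codiff₁_le_of_bound
  abs_col_le hasSum_dz_Rf_codiff₁_superpos tsum_RG_mul_eq_Gf_Rf codiff₁_dz_neg_sq_Gf_Rf blockSum_neg_sq_Gf_Rf exists_bound_neg_sq_Gf_Rf)

noncomputable section

variable (n : ℕ)

/-! ## §1 The R-weighted column candidates -/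

/-- [our object] **THE R-WEIGHTED MINIMISER COLUMN `(Ga𝒬ᵀCun)(·;(l,y₀))`**: the vector kernel `Ga` applied to the coarse-to-fine weight
`𝒬ᵀ(Cun-column (l,y₀))` — `HRcol n Ga Cun l y₀ κ x = Σ'_z Σ_m Ga x z κ m · (𝒬ᵀ Cun(·, y₀; ·, l))_m(z)` (B4's `kerOp₁`).  A data definition; asserts nothing. -/
def HRcol (Ga Cun : MKer 4 (Fin 4)) (l : Fin 4) (y₀ : Site 4) : Form1 4 ℝ :=
  kerOp₁ Ga (contourSumAdj n (fun m' y => Cun y y₀ m' l))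

/-- [our object] **THE GAUGE MULTIPLIER CANDIDATE `−n²·G′R(δℋ_R)`** in brick B1's `RG` shape:
`muCol n a Ga Cun l y₀ p = −n²·Σ'_q (R∘G′)(q,p)·(δ HRcol)(q)`.  A data definition; asserts nothing. -/
def muCol [NeZero n] (a : ℝ) (Ga Cun : MKer 4 (Fin 4)) (l : Fin 4) (y₀ : Site 4) : Form0 4 ℝ :=
  fun p => -((n : ℝ) ^ 2) * ∑' q : Site 4, RG (Ggh n a) (Pgt n a) q p () () * codiff₁ (HRcol n Ga Cun l y₀) q

/-- [folklore] `HRcol` unfolds to the displayed series (`rfl`). -/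
theorem HRcol_apply (Ga Cun : MKer 4 (Fin 4)) (l : Fin 4) (y₀ : Site 4) (κ : Fin 4) (x : Site 4) :
    HRcol n Ga Cun l y₀ κ x = ∑' z : Site 4, ∑ m, Ga x z κ m * contourSumAdj n (fun m' y => Cun y y₀ m' l) m z := rfl

/-- [folklore] A coarse-to-fine weight `𝒬ᵀφ` of a bounded coarse 1-form is bounded: `|(𝒬ᵀφ)_κ(x)| ≤ n·B`. -/
theorem abs_contourSumAdj_le {φ : Form1 4 ℝ} {B : ℝ} (hφ : ∀ κ y, |φ κ y| ≤ B) (κ : Fin 4) (x : Site 4) :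
    |contourSumAdj n φ κ x| ≤ n * B := by
  simp only [AffineReproduction.contourSumAdj]
  calc |∑ s ∈ Finset.range n, φ κ (fun i => (x - (s : ℤ) • unitVec κ) i / (n : ℤ))|
      ≤ ∑ s ∈ Finset.range n, |φ κ (fun i => (x - (s : ℤ) • unitVec κ) i / (n : ℤ))| := Finset.abs_sum_le_sum_abs _ _
    _ ≤ ∑ _s ∈ Finset.range n, B := Finset.sum_le_sum fun s _ => hφ _ _
    _ = n * B := by rw [Finset.sum_const, Finset.card_range, nsmul_eq_mul]

/-- [folklore] The columns of a decaying coarse kernel are bounded by its constant. -/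
theorem abs_Cun_le {Cun : MKer 4 (Fin 4)} {CC δC : ℝ} (hC : Decays Cun CC δC) (hδC : 0 ≤ δC) (l : Fin 4) (y₀ : Site 4)
    (m : Fin 4) (y : Site 4) : |Cun y y₀ m l| ≤ CC :=
  abs_col_le hC hδC l y₀ m y

/-! ## §2 X₁a superposed over the source bonds -/

/-- [folklore] A linear combination of block-constant 0-forms is block-constant. -/
theorem isBlockConst_comb {g₁ g₂ g₃ : Form0 4 ℝ} (h₁ : IsBlockConst n g₁) (h₂ : IsBlockConst n g₂) (h₃ : IsBlockConst n g₃) (c₂ c₃ : ℝ) :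
    IsBlockConst n (fun y => g₁ y + c₂ * g₂ y - c₃ * g₃ y) := by
  intro y bb hb
  simp only [h₁ y bb hb, h₂ y bb hb, h₃ y bb hb]

variable [NeZero n]

section Superposed

variable {Ga : MKer 4 (Fin 4)} {C δ M : ℝ} {b : Form1 4 ℝ} (a : ℝ) {a' c : ℝ}

/-- [folklore] **X₁a SUPERPOSED**: if every column `Ga e_{(m,z)}` satisfies the displayed vector-leg equation
`S(Ga e) + d(R δ(Ga e)) + a′𝒬ᵀ𝒬(Ga e) = c·e`, then for every bounded weight `b` the superposition `A := kerOp₁ Ga b` satisfies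
`S A + d(R δA) + a′𝒬ᵀ𝒬A = c·b` (pointwise) — B4's stencils through `Σ'`, part 1's `R`-term exchange, and uniqueness of sums. -/
theorem el_superposed (ha : 0 < a) (hGa : Decays Ga C δ) (hδ : 0 < δ) (hb : ∀ l z, |b l z| ≤ M)
    (hX1a : ∀ (m : Fin 4) (z : Site 4) (κ : Fin 4) (x : Site 4),
      curvAdj (curv (fun κ' p => Ga p z κ' m)) κ x + dz (Rf n a (codiff₁ (fun κ' p => Ga p z κ' m))) κ x
        + a' * contourSumAdj n (contourSum n (fun κ' p => Ga p z κ' m)) κ x = c * delta1 m z κ x)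
    (κ : Fin 4) (x : Site 4) :
    curvAdj (curv (kerOp₁ Ga b)) κ x + dz (Rf n a (codiff₁ (kerOp₁ Ga b))) κ x
      + a' * contourSumAdj n (contourSum n (kerOp₁ Ga b)) κ x = c * b κ x := by
  -- the three stencil families sum to their values at `A := kerOp₁ Ga b`
  have h1 := hasSum_curvAdj_curv_kerOp₁ hGa hδ hb κ x
  have h2 := hasSum_dz_Rf_codiff₁_superpos n a ha hGa hδ hb κ x
  have h3 := (hasSum_contourSumAdj (N := n) (F := fun z : Site 4 => contourSum n (fun κ p => ∑ m, Ga p z κ m * b m z))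
    (φ := contourSum n (kerOp₁ Ga b)) (fun κ y => hasSum_contourSum_kerOp₁ hGa hδ hb n κ y) κ x).mul_left a'
  have hL := (h1.add h2).add h3
  -- the right-hand sides sum to `c · b κ x` (one source bond carries the weight)
  have h4 : HasSum (fun z : Site 4 => c * ∑ m, b m z * delta1 m z κ x) (c * b κ x) := by
    have h := hasSum_single (f := fun z : Site 4 => c * ∑ m, b m z * delta1 m z κ x) x (fun z hz => by
      simp only [delta1_superpos (fun m => b m z) z κ x, if_neg (Ne.symm hz), mul_zero])
    simp only [delta1_superpos (fun m => b m x) x κ x] at h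
    exact h
  -- termwise, X₁a superposed over the bond directions at the source site `z`
  have hcol : ∀ m z q, |codiff₁ (fun κ' p => Ga p z κ' m) q| ≤ 8 * C := fun m z q =>
    abs_codiff₁_le_of_bound (fun κ' p => abs_col_le hGa hδ.le m z κ' p) q
  have hterm : ∀ z : Site 4,
      curvAdj (curv (fun κ p => ∑ m, Ga p z κ m * b m z)) κ x + dz (Rf n a (codiff₁ (fun κ p => ∑ m, Ga p z κ m * b m z))) κ x
        + a' * contourSumAdj n (contourSum n (fun κ p => ∑ m, Ga p z κ m * b m z)) κ x = c * ∑ m, b m z * delta1 m z κ x := by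
    intro z
    have eS := opEL_superpos' (fun m => fun κ' p => Ga p z κ' m) (fun m => b m z) κ x
    have eQ := QtQ_superpos n (fun m => fun κ' p => Ga p z κ' m) (fun m => b m z) κ x
    have eδ : codiff₁ (fun κ p => ∑ m, Ga p z κ m * b m z) = fun q => ∑ m, b m z * codiff₁ (fun κ' p => Ga p z κ' m) q :=
      funext fun q => codiff₁_superpos (fun m => fun κ' p => Ga p z κ' m) (fun m => b m z) q
    have eR : dz (Rf n a (codiff₁ (fun κ p => ∑ m, Ga p z κ m * b m z))) κ x
        = ∑ m, b m z * dz (Rf n a (codiff₁ (fun κ' p => Ga p z κ' m))) κ x := by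
      rw [eδ, show Rf n a (fun q => ∑ m, b m z * codiff₁ (fun κ' p => Ga p z κ' m) q)
        = fun p => ∑ m, b m z * Rf n a (codiff₁ (fun κ' p => Ga p z κ' m)) p from
        funext fun p => Rf_superpos n a ha (fun m => codiff₁ (fun κ' p => Ga p z κ' m)) (fun m => b m z) (fun m q => hcol m z q) p,
        dz_superpos₀]
    rw [eS, eR, eQ, Finset.mul_sum, Finset.mul_sum, ← Finset.sum_add_distrib, ← Finset.sum_add_distrib]
    refine Finset.sum_congr rfl fun m _ => ?_
    have h := hX1a m z κ x
    calc b m z * curvAdj (curv (fun κ' p => Ga p z κ' m)) κ x + b m z * dz (Rf n a (codiff₁ (fun κ' p => Ga p z κ' m))) κ x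
          + a' * (b m z * contourSumAdj n (contourSum n (fun κ' p => Ga p z κ' m)) κ x)
        = b m z * (curvAdj (curv (fun κ' p => Ga p z κ' m)) κ x + dz (Rf n a (codiff₁ (fun κ' p => Ga p z κ' m))) κ x
          + a' * contourSumAdj n (contourSum n (fun κ' p => Ga p z κ' m)) κ x) := by ring
      _ = c * (b m z * delta1 m z κ x) := by rw [h]; ring
  exact hL.unique (h4.congr_fun fun z => hterm z)

end Superposed

/-! ## §3 The general superposed column solves the typed KKT system from X₁a ALONE (owner's shape request ρ-g5-1) -/

section Solves

variable (a : ℝ) {a' c : ℝ} {Ga : MKer 4 (Fin 4)} {C δ Mω : ℝ} {ω : Form1 4 ℝ}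

/-- [folklore] **THE SUPERPOSED COLUMN SOLVES THE TYPED KKT SYSTEM WITH ITS OWN BLOCK AVERAGES AS DATA — FROM X₁a ALONE.**  For a decaying
vector kernel `Ga` whose columns satisfy X₁a and ANY bounded coarse column `ω`, the fine field `A := Ga𝒬ᵀω` (`kerOp₁ Ga (contourSumAdj n ω)`),
the multiplier `φ := c•ω − a′•𝒬A` and the gauge multiplier `μ := −n²·G′R(δA)` solve `SolvesKKT n 0 (𝒬A) A φ μ`:
(el) X₁a superposed (`el_superposed`) + `Δ₀μ = −RδA` (part 1); (gauge) `δ∘S = 0`, `δ𝒬ᵀ(·)` block-constant, `Δ₀PδA` block-constant (B3);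
(mean) B1∕B4; (avg) `rfl`.  With (X₁b) `𝒬A = δ` this is the tabled instance (§4); the owner's B6′ turns it into `(wΦ + a′)(𝒬Ga𝒬ᵀ) = c` by uniqueness. -/
theorem solvesKKT_superposed (ha : 0 < a) (hGa : Decays Ga C δ) (hδ : 0 < δ) (hω : ∀ κ y, |ω κ y| ≤ Mω)
    (hX1a : ∀ (m : Fin 4) (z : Site 4) (κ : Fin 4) (x : Site 4),
      curvAdj (curv (fun κ' p => Ga p z κ' m)) κ x + dz (Rf n a (codiff₁ (fun κ' p => Ga p z κ' m))) κ x
        + a' * contourSumAdj n (contourSum n (fun κ' p => Ga p z κ' m)) κ x = c * delta1 m z κ x) :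
    SolvesKKT n 0 (contourSum n (kerOp₁ Ga (contourSumAdj n ω))) (kerOp₁ Ga (contourSumAdj n ω))
      (fun κ y => c * ω κ y - a' * contourSum n (kerOp₁ Ga (contourSumAdj n ω)) κ y)
      (fun p => -((n : ℝ) ^ 2) * Gf n a (Rf n a (codiff₁ (kerOp₁ Ga (contourSumAdj n ω)))) p) := by
  -- the weight, the column, its codifferential: all bounded
  set b : Form1 4 ℝ := contourSumAdj n ω with hbdef
  have hb : ∀ m z, |b m z| ≤ n * Mω := fun m z => abs_contourSumAdj_le n hω m z
  set A : Form1 4 ℝ := kerOp₁ Ga b with hAdef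
  have hA : ∀ κ x, |A κ x| ≤ 4 * C * Zl 4 δ * (n * Mω) := fun κ x => abs_kerOp₁_le hGa hδ hb κ x
  set g : Form0 4 ℝ := codiff₁ A with hgdef
  have hg : ∀ q, |g q| ≤ 8 * (4 * C * Zl 4 δ * (n * Mω)) := fun q => abs_codiff₁_le_of_bound hA q
  -- (E1): X₁a superposed
  have hE1 : ∀ κ x, curvAdj (curv A) κ x + dz (Rf n a g) κ x + a' * contourSumAdj n (contourSum n A) κ x = c * b κ x :=
    fun κ x => el_superposed n a ha hGa hδ hb hX1a κ x
  have hΔμ : codiff₁ (dz (fun p => -((n : ℝ) ^ 2) * Gf n a (Rf n a g) p)) = fun p => -Rf n a g p :=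
    funext fun p => codiff₁_dz_neg_sq_Gf_Rf n a ha hg p
  have hφ : ∀ κ x, contourSumAdj n (fun κ y => c * ω κ y - a' * contourSum n A κ y) κ x
      = c * b κ x - a' * contourSumAdj n (contourSum n A) κ x := by
    intro κ x
    simp only [hbdef, AffineReproduction.contourSumAdj, Finset.sum_sub_distrib, Finset.mul_sum]
  refine ⟨fun κ x => ?_, ?_, fun y => ?_, fun κ y => rfl⟩
  · -- (el)
    rw [hΔμ, hφ, Pi.zero_apply, Pi.zero_apply, add_zero]
    have hneg : dz (fun p => -Rf n a g p) κ x = -(dz (Rf n a g) κ x) := by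
      simp only [AffineAveraging.dz]; ring
    rw [hneg]
    linarith [hE1 κ x]
  · -- (gauge): apply `δ` to (E1) read as an identity of 1-forms
    have hfun : curvAdj (curv A) = c • b - dz (Rf n a g) - a' • contourSumAdj n (contourSum n A) := by
      funext κ x
      simp only [Pi.sub_apply, Pi.smul_apply, smul_eq_mul]
      linarith [hE1 κ x]
    have h0 := congrArg codiff₁ hfun
    rw [codiff₁_curvAdj, codiff₁_sub, codiff₁_sub, codiff₁_smul, codiff₁_smul] at h0
    -- `δ d (R g) = Δ₀ g − Δ₀ (P g)`
    have hR : codiff₁ (dz (Rf n a g)) = codiff₁ (dz g) - codiff₁ (dz (Pf n a g)) := by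
      rw [Rf_eq, dz_sub, codiff₁_sub]
      rfl
    rw [hR] at h0
    have hsol : codiff₁ (dz g) = fun y => codiff₁ (dz (Pf n a g)) y + c * codiff₁ b y
        - a' * codiff₁ (contourSumAdj n (contourSum n A)) y := by
      funext y
      have := congr_fun h0 y
      simp only [Pi.zero_apply, Pi.sub_apply, Pi.smul_apply, smul_eq_mul] at this
      linarith
    show IsBlockConst n (codiff₁ (dz g))
    rw [hsol]
    refine isBlockConst_comb n ?_ ?_ ?_ c a'
    · exact isBlockConst_codiff₁_dz_Pf n a ha hg
    · rw [hbdef]; exact isBlockConst_codiff₁_contourSumAdj (N := n) _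
    · exact isBlockConst_codiff₁_contourSumAdj (N := n) _
  · -- (mean)
    exact blockSum_neg_sq_Gf_Rf n a ha hg y

/-- [folklore] **THE CANDIDATE TRIPLE IS TEMPERED** (bounded): `A`, `φ := c•ω − a′•𝒬A`, `μ := −n²·G′R(δA)`. -/
theorem tempered_superposed (ha : 0 < a) (hGa : Decays Ga C δ) (hδ : 0 < δ) (hω : ∀ κ y, |ω κ y| ≤ Mω) :
    Tempered1 (kerOp₁ Ga (contourSumAdj n ω))
      ∧ Tempered1 (fun κ y => c * ω κ y - a' * contourSum n (kerOp₁ Ga (contourSumAdj n ω)) κ y)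
      ∧ Tempered0 (fun p => -((n : ℝ) ^ 2) * Gf n a (Rf n a (codiff₁ (kerOp₁ Ga (contourSumAdj n ω)))) p) := by
  have hb : ∀ m z, |contourSumAdj n ω m z| ≤ n * Mω := fun m z => abs_contourSumAdj_le n hω m z
  have hA : ∀ κ x, |kerOp₁ Ga (contourSumAdj n ω) κ x| ≤ 4 * C * Zl 4 δ * (n * Mω) := fun κ x => abs_kerOp₁_le hGa hδ hb κ x
  have hg : ∀ q, |codiff₁ (kerOp₁ Ga (contourSumAdj n ω)) q| ≤ 8 * (4 * C * Zl 4 δ * (n * Mω)) := fun q => abs_codiff₁_le_of_bound hA q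
  -- `𝒬A` is bounded: a finite sum of `n^4 · n` bounded entries
  have hQ : ∀ κ y, |contourSum n (kerOp₁ Ga (contourSumAdj n ω)) κ y| ≤ ((n : ℝ) ^ 4 * n) * (4 * C * Zl 4 δ * (n * Mω)) := by
    intro κ y
    simp only [AffineAveraging.contourSum]
    have hcard : (box 4 n).card = n ^ 4 := by
      simp only [AffineAveraging.box, Fintype.card_piFinset, Finset.card_range, Finset.prod_const, Finset.card_univ, Fintype.card_fin]
    calc |∑ bb ∈ box 4 n, ∑ s ∈ Finset.range n, kerOp₁ Ga (contourSumAdj n ω) κ ((n : ℤ) • y + toSite bb + (s : ℤ) • unitVec κ)|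
        ≤ ∑ bb ∈ box 4 n, |∑ s ∈ Finset.range n, kerOp₁ Ga (contourSumAdj n ω) κ ((n : ℤ) • y + toSite bb + (s : ℤ) • unitVec κ)| :=
          Finset.abs_sum_le_sum_abs _ _
      _ ≤ ∑ bb ∈ box 4 n, ∑ s ∈ Finset.range n, |kerOp₁ Ga (contourSumAdj n ω) κ ((n : ℤ) • y + toSite bb + (s : ℤ) • unitVec κ)| :=
          Finset.sum_le_sum fun bb _ => Finset.abs_sum_le_sum_abs _ _
      _ ≤ ∑ bb ∈ box 4 n, ∑ _s ∈ Finset.range n, 4 * C * Zl 4 δ * (n * Mω) :=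
          Finset.sum_le_sum fun bb _ => Finset.sum_le_sum fun s _ => hA _ _
      _ = ((n : ℝ) ^ 4 * n) * (4 * C * Zl 4 δ * (n * Mω)) := by
          rw [Finset.sum_const, Finset.sum_const, Finset.card_range, hcard, nsmul_eq_mul, nsmul_eq_mul]; push_cast; ring
  refine ⟨Tempered1.of_bounded hA, Tempered1.of_bounded (B := |c| * Mω + |a'| * (((n : ℝ) ^ 4 * n) * (4 * C * Zl 4 δ * (n * Mω))))
    fun κ y => ?_, ?_⟩
  · refine (abs_sub _ _).trans (add_le_add ?_ ?_)
    · rw [abs_mul]; exact mul_le_mul_of_nonneg_left (hω κ y) (abs_nonneg c)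
    · rw [abs_mul]; exact mul_le_mul_of_nonneg_left (hQ κ y) (abs_nonneg a')
  · obtain ⟨B', hB'⟩ := exists_bound_neg_sq_Gf_Rf n a ha hg
    exact Tempered0.of_bounded hB'

end Solves

/-! ## §4 BRICK B6: the tabled instance `ω := Cun-column (l,0)` + (X₁b), and the dictionary line (D-H) by uniqueness -/

section Main

variable (a : ℝ) {Ga Cun : MKer 4 (Fin 4)}

omit [NeZero n] in
/-- [folklore] `HRcol` IS the superposed column at the weight `ω := Cun(·, y₀; ·, l)` (`rfl`). -/
theorem HRcol_eq_kerOp₁ (Ga Cun : MKer 4 (Fin 4)) (l : Fin 4) (y₀ : Site 4) :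
    HRcol n Ga Cun l y₀ = kerOp₁ Ga (contourSumAdj n (fun m' y => Cun y y₀ m' l)) := rfl

/-- [folklore] **`muCol` (B1's `RG` shape) IS `−n²·Gf (Rf (δ HRcol))`** (part 1 `tsum_RG_mul_eq_Gf_Rf`; `0 < a`, spread `Ga`, `Cun`). -/
theorem muCol_eq (ha : 0 < a) (hGa : Spr Ga) (hCun : Spr Cun) (l : Fin 4) (y₀ : Site 4) :
    muCol n a Ga Cun l y₀ = fun p => -((n : ℝ) ^ 2) * Gf n a (Rf n a (codiff₁ (HRcol n Ga Cun l y₀))) p := by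
  obtain ⟨CG, δG, hδG, hG⟩ := hGa
  obtain ⟨CC, δC, hδC, hCk⟩ := hCun
  have hb : ∀ m z, |contourSumAdj n (fun m' y => Cun y y₀ m' l) m z| ≤ n * CC := fun m z =>
    abs_contourSumAdj_le n (fun m y => abs_Cun_le hCk hδC.le l y₀ m y) m z
  have hg : ∀ q, |codiff₁ (HRcol n Ga Cun l y₀) q| ≤ 8 * (4 * CG * Zl 4 δG * (n * CC)) := fun q =>
    abs_codiff₁_le_of_bound (fun κ x => abs_kerOp₁_le hG hδG hb κ x) q
  funext p
  show -((n : ℝ) ^ 2) * ∑' q : Site 4, RG (Ggh n a) (Pgt n a) q p () () * codiff₁ (HRcol n Ga Cun l y₀) q = _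
  rw [tsum_RG_mul_eq_Gf_Rf n a ha hg p]

/-- [folklore] **THE TABLED CANDIDATE `(HRcol, c•Cun − a′•δ, muCol)` SOLVES `SolvesKKT n 0 δ_{(l,0)}`** under X₁a and (X₁b) `𝒬 HRcol = δ_{(l,0)}`. -/
theorem solvesKKT_HRcol {a' c : ℝ} (ha : 0 < a) (hGa : Spr Ga) (hCun : Spr Cun)
    (hX1a : ∀ (m : Fin 4) (z : Site 4) (κ : Fin 4) (x : Site 4),
      curvAdj (curv (fun κ' p => Ga p z κ' m)) κ x + dz (Rf n a (codiff₁ (fun κ' p => Ga p z κ' m))) κ x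
        + a' * contourSumAdj n (contourSum n (fun κ' p => Ga p z κ' m)) κ x = c * delta1 m z κ x)
    (l : Fin 4)
    (hX1b : ∀ (κ : Fin 4) (y : Site 4), contourSum n (HRcol n Ga Cun l 0) κ y = if y = 0 ∧ κ = l then 1 else 0) :
    SolvesKKT n 0 (fun κ y => if y = 0 ∧ κ = l then 1 else 0) (HRcol n Ga Cun l 0)
      (fun κ y => c * Cun y 0 κ l - a' * (if y = 0 ∧ κ = l then 1 else 0)) (muCol n a Ga Cun l 0) := by
  have hμ := muCol_eq n a ha hGa hCun l 0
  obtain ⟨CG, δG, hδG, hG⟩ := hGa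
  obtain ⟨CC, δC, hδC, hCk⟩ := hCun
  have h := solvesKKT_superposed n a (a' := a') (c := c) ha hG hδG (fun m y => abs_Cun_le hCk hδC.le l 0 m y) hX1a
  have hQ : contourSum n (kerOp₁ Ga (contourSumAdj n (fun m' y => Cun y 0 m' l))) = fun κ y => if y = 0 ∧ κ = l then (1 : ℝ) else 0 :=
    funext fun κ => funext fun y => hX1b κ y
  rw [hQ] at h
  rw [hμ]
  exact h

/-- [folklore] **BRICK B6 (DICT-H) — `wH = Ga𝒬ᵀCun` (column `l`), WITH `wΦ` AND `wM`, CONDITIONAL ON X₁a ∧ X₁b.**  For spread kernels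
`Ga`, `Cun` on `ℤ⁴` satisfying the DISPLAYED vector-leg equations — (X₁a) every column `e ↦ Ga e` solves
`curvAdj (curv ·) + dz (Rf n a (codiff₁ ·)) + a′·contourSumAdj n (contourSum n ·) = c·δ_e` (`Rf n a g = g − Pf n a g`, B4), and (X₁b)
`contourSum n (HRcol n Ga Cun l 0) = δ_{(l,0)}` — the typed minimiser kernels of `KernelSpecInstance` at blocking `n` ARE the R-weighted
candidates: `wH(·;l) = HRcol n Ga Cun l 0`, `wΦ(·;l) = c•Cun(·,0;·,l) − a′•δ_{(l,0)}`, `wM l = muCol n a Ga Cun l 0` — by the UNIQUENESS of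
tempered solutions of the typed block-averaging KKT system (`KKTFluctuationUnique.eq_wH_of_solvesKKT`).  NOTHING here asserts X₁a∕X₁b (an5's ∕ the
owner's X₁; the owner's B6′ derives X₁b from X₁a via `solvesKKT_superposed`). -/
theorem wH_eq_HRcol {a' c : ℝ} (ha : 0 < a) (Ga Cun : MKer 4 (Fin 4)) (hGa : Spr Ga) (hCun : Spr Cun)
    (hX1a : ∀ (m : Fin 4) (z : Site 4) (κ : Fin 4) (x : Site 4),
      curvAdj (curv (fun κ' p => Ga p z κ' m)) κ x + dz (Rf n a (codiff₁ (fun κ' p => Ga p z κ' m))) κ x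
        + a' * contourSumAdj n (contourSum n (fun κ' p => Ga p z κ' m)) κ x = c * delta1 m z κ x)
    (hX1b : ∀ (l κ : Fin 4) (y : Site 4), contourSum n (HRcol n Ga Cun l 0) κ y = if y = 0 ∧ κ = l then 1 else 0)
    (l : Fin 4) :
    (fun κ z => wH (N := n) κ l z) = HRcol n Ga Cun l 0
      ∧ (fun κ y => wΦ (N := n) κ l y) = (fun κ y => c * Cun y 0 κ l - a' * (if y = 0 ∧ κ = l then 1 else 0))
      ∧ wM (N := n) l = muCol n a Ga Cun l 0 := by
  have hsol := solvesKKT_HRcol n a ha hGa hCun hX1a l (hX1b l)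
  have hμ := muCol_eq n a ha hGa hCun l 0
  obtain ⟨CG, δG, hδG, hG⟩ := hGa
  obtain ⟨CC, δC, hδC, hCk⟩ := hCun
  obtain ⟨tA, tφ, tμ⟩ := tempered_superposed n a (a' := a') (c := c) ha hG hδG (fun m y => abs_Cun_le hCk hδC.le l 0 m y)
  have hQ : contourSum n (kerOp₁ Ga (contourSumAdj n (fun m' y => Cun y 0 m' l))) = fun κ y => if y = 0 ∧ κ = l then (1 : ℝ) else 0 :=
    funext fun κ => funext fun y => hX1b l κ y
  rw [hQ] at tφ
  have tμ' : Tempered0 (muCol n a Ga Cun l 0) := by rw [hμ]; exact tμ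
  obtain ⟨h1, h2, h3⟩ := eq_wH_of_solvesKKT (N := n) hsol tA tφ tμ'
  exact ⟨h1.symm, h2.symm, h3.symm⟩

end Main

end

end Summit.QuantumFields.BalabanUV.Beta.D1BFx.LandauDictionaryH
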